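import Mathlib
import HarnessLib
import Summits.Ventures.LatticeQCDFlow.Exactness.IMHReversibleFlowProposals

/-!
# LatticeQCDFlow / Exactness — LATENT-SPACE MOVES THROUGH THE FLOW BIJECTION: a move reversible for the BASE law, conjugated by the flow
# map, is reversible for the flow law — so latent refreshes, latent involutions and latent MCMC steps, read through the flow and accepted
# with the plain importance ratio, are exact

HONEST FRAMING: exact (Metropolis-corrected) sampling algorithms for lattice gauge theory;
figures of merit are autocorrelation/cost numbers at stated couplings and volumes; no
continuum-physics claim.

Venture `LatticeQCDFlow` (cell pub-lqcd), topic `Exactness`, FANOUT row 30 (lean-1 GEN-43, part II: MOVES IN FLOW SPACE; sequel of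
`IMHReversibleFlowProposals`).  NEW WORK of the cell; no definition is introduced, nothing is cited as a fact.  Printed counterparts NAMED
ONLY: transport-map ∕ flow-preconditioned MCMC (Parno–Marzouk, SIAM/ASA JUQ 6 (2018); Hoffman et al. 2019 "NeuTra"; Gabrié–Rotskoff–
Vanden-Eijnden, PNAS 119 (2022)); field-transformation HMC (Lüscher 2010) is the deterministic-flow instance on the gauge side.

## Setting

Latent space `Z` with BASE law `γ` (a probability measure: the flow's prior — a Gaussian, a Haar product); the FLOW MAP as a measurable
bijection `e : Z ≃ᵐ Ω`; the flow law `q = γ.map e`; weight `w > 0` on `Ω`, `π = w·q`.  A LATENT MOVE: a Markov kernel `S` on `Z` reversible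
for `γ`.  Its image through the flow, def-free: ANY kernel `R` on `Ω` with `R(x, B) = S(e⁻¹x, e⁻¹B)` (hypothesis `hR`) — "pull the
configuration back to latent space, move there, push forward".

## Results [all ours]

* **`conj_isReversible`**: `R` is reversible for the flow law `q = γ.map e` whenever `S` is reversible for `γ` (change of variables).
* `conj_apply_univ` ∕ `conj_isMarkovKernel`: `R` is Markov.
* **`latentProposal_invariant` ∕ `latentProposal_isReversible`**: ANY kernel realising "latent move `S` through the flow, accept with
  `min(1, w(y)/w(x))`, else stay" leaves `π = w·(γ.map e)` invariant (by `revProposal_invariant`) — THE LATENT-SPACE FLOW SAMPLERS ARE EXACT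
  WITH THE PLAIN RATIO, for every base law, flow bijection, weight and `γ`-reversible latent move.
* Instances of `γ`-reversible latent moves, def-free: `latentRedraw_isReversible` (a fresh draw from `γ`: the plain flow sampler);
  **`latentInvolution_isReversible`** (the deterministic move along a `γ`-PRESERVING MEASURABLE INVOLUTION `T` — e.g. `z ↦ −z` for a centred
  Gaussian base, a lattice symmetry commuting with the prior): so "propose `e(T(e⁻¹x))`, accept with `min(1, w(y)/w(x))`" is exact
  (`involutionProposal_invariant`).

Not here: the Gaussian autoregressive (Crank–Nicolson) latent kernel's `γ`-reversibility itself (a statement about Gaussian measures, not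
about the sampler), rates.
-/

namespace Summit.Ventures.LatticeQCDFlow.Exactness

open MeasureTheory ProbabilityTheory
open scoped ENNReal

variable {Z Ω : Type*} [MeasurableSpace Z] [MeasurableSpace Ω] {γ : Measure Z} [IsProbabilityMeasure γ] {w : Ω → ℝ}

/-! ## §1 Conjugating a reversible latent move by the flow bijection -/

omit [IsProbabilityMeasure γ] in
/-- **CHANGE OF VARIABLES FOR REVERSIBILITY**: if `S` is `γ`-reversible on latent space and `R(x, B) = S(e⁻¹x, e⁻¹B)`, then `R` is
reversible for the flow law `γ.map e`. [ours] -/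
theorem conj_isReversible (e : Z ≃ᵐ Ω) (S : Kernel Z Z) (hS : Kernel.IsReversible S γ) (R : Kernel Ω Ω)
    (hR : ∀ (x : Ω) {B : Set Ω}, MeasurableSet B → R x B = S (e.symm x) (e ⁻¹' B)) :
    Kernel.IsReversible R (γ.map e) := by
  intro A B hA hB
  rw [setLIntegral_map hA (Kernel.measurable_coe R hB) e.measurable,
    setLIntegral_map hB (Kernel.measurable_coe R hA) e.measurable]
  simp_rw [hR _ hB, hR _ hA, e.symm_apply_apply]
  exact hS (e.measurable hA) (e.measurable hB)

omit [IsProbabilityMeasure γ] in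
/-- `R(x, Ω) = 1`. [ours, bookkeeping] -/
theorem conj_apply_univ (e : Z ≃ᵐ Ω) (S : Kernel Z Z) [IsMarkovKernel S] (R : Kernel Ω Ω)
    (hR : ∀ (x : Ω) {B : Set Ω}, MeasurableSet B → R x B = S (e.symm x) (e ⁻¹' B)) (x : Ω) : R x Set.univ = 1 := by
  rw [hR x MeasurableSet.univ, Set.preimage_univ, measure_univ]

omit [IsProbabilityMeasure γ] in
/-- The conjugated kernel is Markov. [ours, bookkeeping] -/
theorem conj_isMarkovKernel (e : Z ≃ᵐ Ω) (S : Kernel Z Z) [IsMarkovKernel S] (R : Kernel Ω Ω)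
    (hR : ∀ (x : Ω) {B : Set Ω}, MeasurableSet B → R x B = S (e.symm x) (e ⁻¹' B)) : IsMarkovKernel R :=
  ⟨fun x => ⟨conj_apply_univ e S R hR x⟩⟩

/-- The flow law is a probability measure. [ours, bookkeeping] -/
theorem isProbabilityMeasure_flowLaw (e : Z ≃ᵐ Ω) : IsProbabilityMeasure (γ.map e) :=
  Measure.isProbabilityMeasure_map e.measurable.aemeasurable

/-! ## §2 Latent-space flow samplers are exact with the plain ratio -/

/-- **LATENT MOVES THROUGH THE FLOW ARE EXACT — DETAILED BALANCE**: for every base law `γ`, flow bijection `e`, positive measurable weight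
`w`, `γ`-reversible latent Markov kernel `S`, its image `R` through the flow, and ANY kernel `K` realising "propose from `R`, accept with
`min(1, w(y)/w(x))`, else stay": `K` is reversible for `π = w·(γ.map e)`. [ours] -/
theorem latentProposal_isReversible (hw : Measurable w) (hw0 : ∀ x, 0 < w x) (e : Z ≃ᵐ Ω) (S : Kernel Z Z) [IsMarkovKernel S]
    (hS : Kernel.IsReversible S γ) (R : Kernel Ω Ω)
    (hR : ∀ (x : Ω) {B : Set Ω}, MeasurableSet B → R x B = S (e.symm x) (e ⁻¹' B)) (K : Kernel Ω Ω)
    (hK : ∀ (x : Ω) {B : Set Ω}, MeasurableSet B → K x B =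
      ∫⁻ y in B, imhAcceptE w x y ∂(R x) + (1 - ∫⁻ y, imhAcceptE w x y ∂(R x)) * B.indicator 1 x) :
    Kernel.IsReversible K ((γ.map e).withDensity fun x => ENNReal.ofReal (w x)) := by
  haveI := isProbabilityMeasure_flowLaw (γ := γ) e
  haveI := conj_isMarkovKernel e S R hR
  exact revProposal_isReversible hw hw0 R (conj_isReversible e S hS R hR) K hK

/-- **… INVARIANCE**: `π = w·(γ.map e)` is invariant — latent refreshes, latent involutions and latent MCMC steps read through the flow and
accepted with the plain importance ratio sample the target exactly. [ours] -/
theorem latentProposal_invariant (hw : Measurable w) (hw0 : ∀ x, 0 < w x) (e : Z ≃ᵐ Ω) (S : Kernel Z Z) [IsMarkovKernel S]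
    (hS : Kernel.IsReversible S γ) (R : Kernel Ω Ω)
    (hR : ∀ (x : Ω) {B : Set Ω}, MeasurableSet B → R x B = S (e.symm x) (e ⁻¹' B)) (K : Kernel Ω Ω)
    (hK : ∀ (x : Ω) {B : Set Ω}, MeasurableSet B → K x B =
      ∫⁻ y in B, imhAcceptE w x y ∂(R x) + (1 - ∫⁻ y, imhAcceptE w x y ∂(R x)) * B.indicator 1 x) :
    Kernel.Invariant K ((γ.map e).withDensity fun x => ENNReal.ofReal (w x)) := by
  haveI := isProbabilityMeasure_flowLaw (γ := γ) e
  haveI := conj_isMarkovKernel e S R hR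
  exact revProposal_invariant hw hw0 R (conj_isReversible e S hS R hR) K hK

/-! ## §3 Reversible latent moves, def-free -/

omit [IsProbabilityMeasure γ] in
/-- **A fresh draw from the base law** (`S(z, ·) = γ`) is `γ`-reversible — its image through the flow is the independent flow proposal.
[ours] -/
theorem latentRedraw_isReversible (S : Kernel Z Z) (hS : ∀ (z : Z) {B : Set Z}, MeasurableSet B → S z B = γ B) :
    Kernel.IsReversible S γ := by
  intro A B hA hB
  simp_rw [hS _ hB, hS _ hA]
  rw [setLIntegral_const, setLIntegral_const, mul_comm]

omit [IsProbabilityMeasure γ] in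
/-- **THE DETERMINISTIC MOVE ALONG A `γ`-PRESERVING MEASURABLE INVOLUTION IS `γ`-REVERSIBLE**: if `T ∘ T = id`, `γ.map T = γ` and
`S(z, B) = 1_B(T z)`, then `∫_A S(z, B) dγ = γ(A ∩ T⁻¹B) = γ(B ∩ T⁻¹A) = ∫_B S(z, A) dγ`. [ours] -/
theorem latentInvolution_isReversible {T : Z → Z} (hT : Measurable T) (hTT : ∀ z, T (T z) = z) (hγ : γ.map T = γ) (S : Kernel Z Z)
    (hS : ∀ (z : Z) {B : Set Z}, MeasurableSet B → S z B = B.indicator 1 (T z)) :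
    Kernel.IsReversible S γ := by
  have hind : ∀ {B : Set Z} (z : Z), B.indicator (1 : Z → ℝ≥0∞) (T z) = (T ⁻¹' B).indicator 1 z := fun {B} z => by
    by_cases h : T z ∈ B
    · rw [Set.indicator_of_mem h, Set.indicator_of_mem (Set.mem_preimage.2 h)]; rfl
    · rw [Set.indicator_of_notMem h, Set.indicator_of_notMem (fun h' => h (Set.mem_preimage.1 h'))]
  have key : ∀ {A B : Set Z}, MeasurableSet A → MeasurableSet B → ∫⁻ z in A, S z B ∂γ = γ (A ∩ T ⁻¹' B) := by
    intro A B hA hB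
    simp_rw [hS _ hB, hind]
    rw [lintegral_indicator_one (hT hB), Measure.restrict_apply (hT hB), Set.inter_comm]
  intro A B hA hB
  rw [key hA hB, key hB hA]
  -- `γ(A ∩ T⁻¹B) = γ(T⁻¹(T⁻¹A ∩ B)) = (γ.map T)(T⁻¹A ∩ B) = γ(B ∩ T⁻¹A)`
  have hpre : T ⁻¹' (T ⁻¹' A ∩ B) = A ∩ T ⁻¹' B := by
    ext z
    simp only [Set.mem_preimage, Set.mem_inter_iff, hTT]
  rw [← hpre, ← Measure.map_apply hT ((hT hA).inter hB), hγ, Set.inter_comm]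

/-- **THE INVOLUTION PROPOSAL THROUGH THE FLOW IS EXACT**: "propose `y = e(T(e⁻¹x))`, accept with `min(1, w(y)/w(x))`" leaves
`π = w·(γ.map e)` invariant, for every `γ`-preserving measurable involution `T` of latent space. [ours] -/
theorem involutionProposal_invariant (hw : Measurable w) (hw0 : ∀ x, 0 < w x) (e : Z ≃ᵐ Ω) {T : Z → Z} (hT : Measurable T)
    (hTT : ∀ z, T (T z) = z) (hγ : γ.map T = γ) (S : Kernel Z Z) [IsMarkovKernel S]
    (hS : ∀ (z : Z) {B : Set Z}, MeasurableSet B → S z B = B.indicator 1 (T z)) (R : Kernel Ω Ω)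
    (hR : ∀ (x : Ω) {B : Set Ω}, MeasurableSet B → R x B = S (e.symm x) (e ⁻¹' B)) (K : Kernel Ω Ω)
    (hK : ∀ (x : Ω) {B : Set Ω}, MeasurableSet B → K x B =
      ∫⁻ y in B, imhAcceptE w x y ∂(R x) + (1 - ∫⁻ y, imhAcceptE w x y ∂(R x)) * B.indicator 1 x) :
    Kernel.Invariant K ((γ.map e).withDensity fun x => ENNReal.ofReal (w x)) :=
  latentProposal_invariant hw hw0 e S (latentInvolution_isReversible hT hTT hγ S hS) R hR K hK

omit [IsProbabilityMeasure γ] in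
/-- The deterministic involution kernel exists as a Markov kernel (`Kernel.deterministic T`), so the hypotheses above are not vacuous.
[ours, remark] -/
theorem involutionKernel_exists {T : Z → Z} (hT : Measurable T) :
    ∃ S : Kernel Z Z, IsMarkovKernel S ∧ ∀ (z : Z) {B : Set Z}, MeasurableSet B → S z B = B.indicator 1 (T z) :=
  ⟨Kernel.deterministic T hT, inferInstance, fun z _ hB => by
    rw [Kernel.deterministic_apply' hT z hB]; rfl⟩

end Summit.Ventures.LatticeQCDFlow.Exactness
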